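import Summits.BirchSwinnertonDyer.BirchSwinnertonDyer.Theorems.EisensteinPrimesGreenbergFullAtCRK
import Summits.BirchSwinnertonDyer.BirchSwinnertonDyer.Theorems.EisensteinPrimesGreenbergArchimedeanH1
import Summits.BirchSwinnertonDyer.BirchSwinnertonDyer.Theorems.EisensteinPrimesTwistDeformationCofree
import Literature.NumberTheory.IwasawaTheory.IwasawaAlgebraTwoVar
import HarnessLib

/-!
# Route `EisensteinPrimes` (rung K5), crux 2 `GoodLatticeBDPValue`, line `halves` v5, stub
# `stub_noPseudoNull`, road (γ): THE INSTANCE — Greenberg 2016 Prop. 4.1.1 (c) for the twist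
# deformation `𝐃 = Ind_{K̃_∞/K}(A)` of a corank-one `A` over the `ℤ_p²`-tower of an imaginary
# quadratic field, with every kernel-reachable clause discharged and the remainder NAMED
# (helper for stmt-BirchSwinnertonDyer-19032)

Cell `bsd-eis`, seat `bsd-eis-k5-c2` (gen 8) — the "consumption skeleton" of planner RULING L55 (A)
/ L59 (1) (G1 of record = `EisensteinPrimesTwistDeformationCofree`). `twistDeformation_fullAtSelmer_isAlmostDivisible`
assembles, for `Λ = R = Λ₂ = ℤ_p⟦T₂⟧⟦T₁⟧` (standing clauses: k5-ty `IwasawaAlgebraTwoVar`) and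
`ρ = twistDeformation S hS κ₁ κ₂ ρ₀` on `𝐃 = IndModule₂ ℤ_[p] p A`:
hT / RFX / corank 1 / cofinite generation (`…TwistDeformationCofree`), `𝓛_𝔭` stable / almost
divisible / clause (c) (`…GreenbergFullAtSelmer`), LOC_v⁽¹⁾ and LOC_v⁽²⁾ at the finite places of `Σ`
from ONE `σ_v ∈ Γ_{K_v}` with `κ(σ_v) ≠ 0` each (`…TwistDeformationLocalConditions`), LOC⁽²⁾ at the
complex places (k5-ty `Greenberg2016.loc2_inl_of_isComplex`), and CRK from its corank inputs
(`…GreenbergCorankAlgebra`, `…GreenbergFullAtCRK`, `…GreenbergArchimedeanH1`: `h₀ = 0` global/local,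
`corank H¹(K_Σ/K, 𝐃) = 1` by Prop. 4.1, `corank H¹(K_𝔭̄, 𝐃) = 1` by Prop. 4.2 (a), `corank H²(K_v, 𝐃) = 0`
by §5 A, `H¹(K_v, 𝐃)` cotorsion at `v ∤ p` by Prop. 4.2 (b) and at `∞`).

WHAT STAYS NAMED (hypotheses; HOME/k5-c2-MEMO-8.md §3): the five PUBLISHED facts (Prop. 4.1.1,
Prop. 4.2.2, [Gr4] §5 A, Props. 4.1 / 4.2); `LEO S ρ` and `corank H²(K_Σ/K, 𝐃) = 0` (weak Leopoldt
above the cyclotomic tower + Shapiro in degree 2); `corank S_{𝓛_𝔭}(K, 𝐃) = 0` (Rubin 5.3 (iii) /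
BCGKPST §3.3 through the Shapiro bridge K-Sh); cofinite generation of `H¹(K_v, 𝐃)` at the finite
`v ∈ S ∖ {𝔭, 𝔭̄}` ([Gr4] Prop. 3.2); and the INSTANCE DATA — `A` `p`-primary of corank one for
`ℚ/ℤ`- and `K̄ˣ`-duality (`jQ`, `jU`: k5-ty's Prüfer brick, RULING L59 (1)), `ρ₀` acting by unit
scalars (a character) and `Γ_{K_v}` acting on `jU(A)` by scalars (the cyclotomic character), one
`σ_v ∈ Γ_{K_v}` with `κ(σ_v) ≠ 0` at each finite `v ∈ S` (`v ∣ p` ramified, `v ∤ p` Frobenius), and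
`S ∩ {v ∣ p} = {𝔭, 𝔭̄}` with `𝔭̄` of local degree one. Theorems only; no named fact introduced, no
`sorry`. HONEST FRAMING: conditional on the named inputs; closes nothing by itself (`--supports`);
the descent to `Rubin1991.DualData₂` (K-Sh) is NOT here.
References: [Greenberg2016Selmer] Prop. 4.1.1 (c) p. 15, §4.3 p. 20; [Greenberg2006] Props. 4.1–4.2
pp. 367–368, §5 A p. 373; [Greenberg2010] Lemma 5.2.2.
-/

set_option autoImplicit false
set_option linter.dupNamespace false

noncomputable section

open scoped Classical
open NumberField IsDedekindDomain Field PowerSeries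
open Literature.NumberTheory.EllipticCurves Literature.NumberTheory.GaloisRepresentations
  Literature.NumberTheory.IwasawaTheory Literature.NumberTheory.IwasawaTheory.Greenberg2016
  Literature.NumberTheory.IwasawaTheory.Greenberg2006
  Summit.BirchSwinnertonDyer.BirchSwinnertonDyer.Theorems.TwistDeformationCofree

namespace Summit.BirchSwinnertonDyer.BirchSwinnertonDyer.Theorems.GreenbergFullAtSelmer

variable {K : Type} [Field K] [NumberField K] {S : Set (HeightOneSpectrum (𝓞 K))} {p : ℕ} [Fact p.Prime]
  {A : Type} [AddCommGroup A] [Module ℤ_[p] A] [TopologicalSpace A] [DiscreteTopology A]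
  [TopologicalSpace (PowerSeries ℤ_[p])] [TopologicalSpace (PowerSeries (PowerSeries ℤ_[p]))]
  [IsTopologicalRing (PowerSeries (PowerSeries ℤ_[p]))]
  [IsTopologicalAddGroup (IndModule₂ ℤ_[p] p A)]
  [ContinuousSMul (PowerSeries (PowerSeries ℤ_[p])) (IndModule₂ ℤ_[p] p A)]
  (hS : ∀ v : HeightOneSpectrum (𝓞 K), ((p : ℕ) : 𝓞 K) ∈ v.asIdeal → v ∈ S)
  (κ₁ κ₂ : ZpExtension K p) (ρ₀ : ContinuousRep (GaloisGroupUnramifiedOutside K S) ℤ_[p] A)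

/-- **Prop. 4.1.1 (c) AT THE INSTANCE — `S_{𝓛_𝔭}(K, 𝐃)` is almost divisible for the twist deformation
`𝐃 = Ind_{K̃_∞/K}(A)` of a corank-one `A` over the `ℤ_p²`-tower of a totally imaginary `K` with one
complex place**, granted: the five published facts; LEO and `corank H²(K_Σ/K, 𝐃) = 0`;
`corank S_{𝓛_𝔭} = 0`; cofinite generation of `H¹(K_v, 𝐃)` at the finite `v ∈ S` other than `𝔭, 𝔭̄`;
and the instance data (see the module docstring). Every other clause of Prop. 4.1.1 (c) — `𝓛`
stable and almost divisible, (c), RFX, `IsCofree`, cofinite generation and `p`-primarity of `𝐃`,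
LOC⁽¹⁾ at `𝔭`, LOC⁽²⁾ on all of `Σ`, CRK — is DISCHARGED here from the kernel theorems of road (γ).
[cite: Greenberg2016Selmer, Prop. 4.1.1 (c) (§4.1 p. 15 L21–32), §4.3 p. 20 L19–30]
[cite: Greenberg2006, Prop. 4.1, Prop. 4.2 (§4 A pp. 367–368), §5 A (p. 373)] -/
theorem twistDeformation_fullAtSelmer_isAlmostDivisible
    (h411 : prop411_selmer_isAlmostDivisible) (h422 : prop422_localCohomology_isAlmostDivisible)
    (h5A : sec5A_localH2_subsingleton_of_LOC1) (h41 : prop41_globalEulerPoincareCorank)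
    (h42 : prop42_localEulerPoincareCorank)
    (hSf : S.Finite) (hK : ∀ w : InfinitePlace K, w.IsComplex)
    (hr₂ : InfinitePlace.nrComplexPlaces K = 1)
    -- the instance data
    (hA : ∀ a : A, ∃ k : ℕ, p ^ k • a = 0)
    (jQ : A →+ AddCircle (1 : ℚ)) (hinjQ : ∀ c : ℤ_[p], (∀ a : A, jQ (c • a) = 0) → c = 0)
    (hsurjQ : ∀ φ : A →+ AddCircle (1 : ℚ), ∃ c : ℤ_[p], ∀ a : A, φ a = jQ (c • a))
    (jU : A →+ DiscreteGaloisModule.UnitsCarrier K)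
    (hinjU : ∀ c : ℤ_[p], (∀ a : A, jU (c • a) = 0) → c = 0)
    (hsurjU : ∀ φ : A →+ DiscreteGaloisModule.UnitsCarrier K, ∃ c : ℤ_[p], ∀ a : A, φ a = jU (c • a))
    (hscalar : ∀ g : GaloisGroupUnramifiedOutside K S, ∃ t : ℤ_[p]ˣ, ∀ a : A, ρ₀ g a = (t : ℤ_[p]) • a)
    (hcyc : ∀ (v : Place K) (σ : absoluteGaloisGroup v.Completion), ∃ u : ℤ_[p], ∀ a : A,
      DiscreteGaloisModule.units K (absGaloisRestrict K v.Completion σ) (jU a) = jU (u • a))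
    (hsup : ∀ v : HeightOneSpectrum (𝓞 K), v ∈ S →
      ∃ σ : absoluteGaloisGroup (Place.Completion (Sum.inr v : Place K)),
        κ₁ (absGaloisRestrict K _ σ) ≠ 1 ∨ κ₂ (absGaloisRestrict K _ σ) ≠ 1)
    {𝔭 𝔭bar : HeightOneSpectrum (𝓞 K)} (h𝔭 : 𝔭 ∈ S) (h𝔭bar : 𝔭bar ∈ S) (hne : 𝔭bar ≠ 𝔭)
    (hp𝔭bar : ((p : ℕ) : 𝓞 K) ∈ 𝔭bar.asIdeal)
    (hdeg : 𝔭bar.asIdeal.ramificationIdx ℤ * 𝔭bar.asIdeal.inertiaDeg ℤ = 1)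
    (hSp : ∀ v : HeightOneSpectrum (𝓞 K), v ∈ S → ((p : ℕ) : 𝓞 K) ∈ v.asIdeal → v = 𝔭 ∨ v = 𝔭bar)
    -- the named remainder
    (hLEO : LEO S (twistDeformation S hS κ₁ κ₂ ρ₀))
    (h2 : HasCorank (IwasawaAlgebra₂ p) ((twistDeformation S hS κ₁ κ₂ ρ₀).H 2) 0)
    (hSel : HasCorank (IwasawaAlgebra₂ p)
      (fullAtSpecification S (twistDeformation S hS κ₁ κ₂ ρ₀) (Sum.inr 𝔭)).selmer 0)
    (hcfg : ∀ v : HeightOneSpectrum (𝓞 K), v ∈ S → v ≠ 𝔭 → v ≠ 𝔭bar →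
      IsCofinitelyGenerated (IwasawaAlgebra₂ p)
        ((localRep S (twistDeformation S hS κ₁ κ₂ ρ₀) (Sum.inr v)).H 1)) :
    Greenberg2016.IsAlmostDivisible (IwasawaAlgebra₂ p)
      (fullAtSpecification S (twistDeformation S hS κ₁ κ₂ ρ₀) (Sum.inr 𝔭)).selmer := by
  set ρ := twistDeformation S hS κ₁ κ₂ ρ₀ with hρ
  -- standing clauses of the arena at `Λ = R = Λ₂`
  have hΛ := nonempty_iwasawaAlgebraTwoVar_ringEquiv_mvPowerSeries p
  have hcpl := isAdicComplete_maximalIdeal_iwasawaAlgebraTwoVar p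
  have hres := finite_residueField_iwasawaAlgebraTwoVar p
  have hchar := charP_residueField_iwasawaAlgebraTwoVar p
  have hinj : Function.Injective
      (algebraMap (PowerSeries (PowerSeries ℤ_[p])) (PowerSeries (PowerSeries ℤ_[p]))) :=
    fun a b h ↦ by simpa using h
  have hfin : Module.Finite (PowerSeries (PowerSeries ℤ_[p])) (PowerSeries (PowerSeries ℤ_[p])) :=
    inferInstance
  have hlin : ∀ (g : GaloisGroupUnramifiedOutside K S) (r : PowerSeries (PowerSeries ℤ_[p]))
      (d : IndModule₂ ℤ_[p] p A), ρ g (r • d) = r • ρ g d :=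
    fun g r d ↦ twistDeformation_smul S hS κ₁ κ₂ ρ₀ g r d
  -- `𝐃`: cofree of corank one, cofinitely generated, `p`-primary, RFX
  have hT := isCofree_indModule₂ hA jQ hinjQ hsurjQ
  have hcf := isCofinitelyGenerated_indModule₂ hA jQ hinjQ hsurjQ
  have hm := hasCorank_one_indModule₂ hA jQ hinjQ hsurjQ
  have hRFX := rfx_indModule₂ hA jQ hinjQ hsurjQ
  have hpD : ∀ d : IndModule₂ ℤ_[p] p A, ∃ n : ℕ, (p ^ n : ℤ) • d = 0 :=
    IndModule₂.exists_pow_smul_eq_zero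
  -- local conditions at the finite places of `Σ` from the `σ`-supply
  have hLOC1fin : ∀ v : HeightOneSpectrum (𝓞 K), v ∈ S → LOC1 S ρ (Sum.inr v) := fun v hv ↦ by
    obtain ⟨σ, hσ⟩ := hsup v hv
    obtain ⟨t, ht⟩ := hscalar (localToUnramified S (Sum.inr v) σ)
    obtain ⟨u, hu⟩ := hcyc (Sum.inr v) σ
    exact twistDeformation_LOC1 S hS κ₁ κ₂ ρ₀ hA jU hinjU hsurjU (Sum.inr v) σ t ht hu hσ
  have hLOC2 : ∀ v : Place K, InSigma S v → LOC2 S ρ v := by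
    rintro (w | v) hv
    · exact loc2_inl_of_isComplex S ρ w (hK w)
    · obtain ⟨σ, hσ⟩ := hsup v ((inSigma_inr_iff S v).mp hv)
      obtain ⟨t, ht⟩ := hscalar (localToUnramified S (Sum.inr v) σ)
      obtain ⟨u, hu⟩ := hcyc (Sum.inr v) σ
      exact twistDeformation_LOC2 S hS κ₁ κ₂ ρ₀ hA jU hinjU hsurjU (Sum.inr v) σ t ht hu hσ
  have h0loc : ∀ v : HeightOneSpectrum (𝓞 K), v ∈ S →
      HasCorank (IwasawaAlgebra₂ p) ((localRep S ρ (Sum.inr v)).H 0) 0 := fun v hv ↦ by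
    obtain ⟨σ, hσ⟩ := hsup v hv
    obtain ⟨t, ht⟩ := hscalar (localToUnramified S (Sum.inr v) σ)
    exact hasCorank_localH0_twistDeformation_zero S hS κ₁ κ₂ ρ₀ (Sum.inr v) σ t ht hσ
  have h2loc : ∀ v : HeightOneSpectrum (𝓞 K), v ∈ S →
      HasCorank (IwasawaAlgebra₂ p) ((localRep S ρ (Sum.inr v)).H 2) 0 := fun v hv ↦
    hasCorank_localH2_zero_of_sec5A ρ h5A hSf hS hΛ hpD hcf (hLOC1fin v hv)
  -- CRK from its corank inputs
  have h0 : HasCorank (IwasawaAlgebra₂ p) (ρ.H 0) 0 :=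
    hasCorank_H0_twistDeformation_zero S hS κ₁ κ₂ ρ₀ hscalar
  have hH1 : HasCorank (IwasawaAlgebra₂ p) (ρ.H 1) 1 :=
    hasCorank_H1_one_of_prop41 ρ h41 hSf hS hK hr₂ hΛ hpD hcf hm h0 h2
  have hη'1 : HasCorank (IwasawaAlgebra₂ p) ((localRep S ρ (Sum.inr 𝔭bar)).H 1) 1 :=
    hasCorank_localH1_of_prop42_degree_one ρ h42 hSf hS hΛ hpD hcf hp𝔭bar hdeg hm
      (h0loc 𝔭bar h𝔭bar) (h2loc 𝔭bar h𝔭bar)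
  have hcot : ∀ v : Place K, InSigma S v → v ≠ Sum.inr 𝔭 → v ≠ Sum.inr 𝔭bar →
      IsCotorsion (IwasawaAlgebra₂ p) ((localRep S ρ v).H 1) := by
    rintro (w | v) hv h1 h2'
    · exact isCotorsion_localH1_inl_of_isComplex S ρ (hK w)
    · have hvS : v ∈ S := (inSigma_inr_iff S v).mp hv
      have hv𝔭 : v ≠ 𝔭 := fun h ↦ h1 (by rw [h])
      have hv𝔭bar : v ≠ 𝔭bar := fun h ↦ h2' (by rw [h])
      have hvp : ((p : ℕ) : 𝓞 K) ∉ v.asIdeal := fun h ↦ by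
        rcases hSp v hvS h with h' | h'
        · exact hv𝔭 h'
        · exact hv𝔭bar h'
      exact isCotorsion_localH1_of_prop42 ρ h42 hSf hS hΛ hpD hcf hvp hm (h0loc v hvS) (h2loc v hvS)
        (hcfg v hvS hv𝔭 hv𝔭bar)
  have hCRK : (fullAtSpecification S ρ (Sum.inr 𝔭)).CRK :=
    CRK_fullAt_of_coranks hSf h𝔭bar hne hH1 hSel hη'1 hcot
  -- Prop. 4.1.1 (c)
  exact fullAtSelmer_isAlmostDivisible_of_facts h411 h422 h5A hSf hS hΛ hinj hfin hcpl hres hchar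
    hlin hT hcf hpD hRFX hLEO hLOC2 h𝔭 (hLOC1fin 𝔭 h𝔭) hCRK

end Summit.BirchSwinnertonDyer.BirchSwinnertonDyer.Theorems.GreenbergFullAtSelmer

end
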